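import Mathlib
import Summits.NavierStokesRegularity.NavierStokesRegularity.Theorems.FilamentSkeletonRssKelvinGateFreeBounds

/-!
# Route `FilamentSkeletonRss` · crux `TransverseReductionRJ` (stmt-NavierStokesRegularity-21221) — line `kelvin_gate`,
# stub S2′ `EventualKelvinGate`: the free resolvent `W = ∫₀^∞ W_s ds` is `C²` with X-scale decay

Helper file (theorems only, `--supports stmt-NavierStokesRegularity-21221 --as helper`).  HONEST FRAMING:
analysis bookkeeping for a HYPOTHETICAL filament-type rotating-self-similar blow-up route; nothing here
bears on Navier–Stokes regularity; no stub is proved here.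

For `F ∈ C¹(ℝ³; ℝ³)` bounded with bounded derivative and a rate `α`, the FREE RESOLVENT of the line's
linearised profile operator at the trivial base is the Laplace integral of the free semigroup slices of
`…KelvinGateOUSlice`,

  `W(y) = ∫₀^∞ W_s(y) ds`,  `W_s(y) = (e^{-s/2} R_{−αs}) (e^{(1 − e^{-s})Δ} F)(e^{-s/2} R_{αs} y)`

(written out in every statement; no definitions).  This file differentiates under the integral sign
(dominated by the bounds of `…KelvinGateFreeBounds`):

* `integrableOn_freeSlice`, `integrableOn_fderiv_freeSlice`;
* `hasFDerivAt_freeResolvent` — `DW(y) = ∫₀^∞ DW_s(y) ds`; `hasFDerivAt_fderiv_freeResolvent` —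
  `D²W(y) = ∫₀^∞ D²W_s(y) ds`; `continuous_fderiv_fderiv_freeResolvent`; `contDiff_two_freeResolvent`;
* `weight_norm_freeResolvent_le`, `weight_norm_fderiv_freeResolvent_le`, `weight_norm_fderiv_fderiv_freeResolvent_le` — **the Y → X estimates**: if `(1+|z|)² ‖F z‖ ≤ A` and `(1+|z|)² ‖DF z‖ ≤ A'` then
  `(1+|y|) ‖W(y)‖ ≤ 4 C_G A`, `(1+|y|) ‖DW(y)‖ ≤ 4 C_G A'`, `(1+|y|) ‖D²W(y)‖ ≤ 5·2^{3/2} C_G A' · I`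
  (`C_G` the caloric weight constant of `…KelvinGateHeatWeight`, `I = ∫₀^∞ s^{-1/2} e^{-s/2} ds`), i.e.
  `XBound W (C · max A A')` with an ABSOLUTE constant `C` (independent of `α`).
The equation `𝓛_(α,0) W = F` is the next file.
-/

set_option linter.dupNamespace false

noncomputable section

namespace Summit.NavierStokesRegularity.NavierStokesRegularity.Theorems.KelvinGate

open Set Function Filter Topology InnerProductSpace MeasureTheory Real Metric
open Literature.Analysis.FluidPDE Literature.Analysis.UnboundedOperators
open scoped Laplacian RealInnerProductSpace ContDiff Topology ENNReal

section Resolvent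

variable {F : EuclideanSpace ℝ (Fin 3) → EuclideanSpace ℝ (Fin 3)} {C₀ C₁ : ℝ}

/-! ## Integrability of the slices and their space derivatives on `(0, ∞)` -/

/-- `s ↦ W_s(y)` is integrable on `(0, ∞)` (dominated by `C₀ e^{-s/2}`). -/
theorem integrableOn_freeSlice (hF : Continuous F) (h0 : ∀ z, ‖F z‖ ≤ C₀) (α : ℝ) (y : EuclideanSpace ℝ (Fin 3)) :
    IntegrableOn (fun s : ℝ => (Real.exp (-(s / 2)) • rotZL (-(α * s)))
        (heatExtension F (1 - Real.exp (-s)) ((Real.exp (-(s / 2)) • rotZL (α * s)) y))) (Ioi 0) := by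
  refine Integrable.mono' ((integral_exp_neg_half_Ioi.1).mul_const C₀) ?_ ?_
  · exact (continuousOn_freeSlice hF h0 α y).aestronglyMeasurable measurableSet_Ioi
  · exact (ae_restrict_iff' measurableSet_Ioi).2 (Eventually.of_forall fun s hs => norm_freeSlice_le h0 α hs y)

/-- `s ↦ DW_s(y)` is integrable on `(0, ∞)` (dominated by `C₁ e^{-s}`). -/
theorem integrableOn_fderiv_freeSlice (hF : ContDiff ℝ 1 F) (h0 : ∀ z, ‖F z‖ ≤ C₀) (h1 : ∀ z, ‖fderiv ℝ F z‖ ≤ C₁)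
    (α : ℝ) (y : EuclideanSpace ℝ (Fin 3)) :
    IntegrableOn (fun s : ℝ => fderiv ℝ (fun z => (Real.exp (-(s / 2)) • rotZL (-(α * s)))
        (heatExtension F (1 - Real.exp (-s)) ((Real.exp (-(s / 2)) • rotZL (α * s)) z))) y) (Ioi 0) := by
  refine Integrable.mono' (((integrableOn_exp_neg_Ioi 0).const_mul C₁)) ?_ ?_
  · exact (continuousOn_fderiv_freeSlice hF.continuous h0 α y).aestronglyMeasurable measurableSet_Ioi
  · exact (ae_restrict_iff' measurableSet_Ioi).2
      (Eventually.of_forall fun s hs => norm_fderiv_freeSlice_le_exp hF h0 h1 α hs y)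

/- (Integrability of `s ↦ D²W_s(y)` — values in `ℝ³ →L (ℝ³ →L ℝ³)` — is not stated on its own: the
`IntegrableOn` elaborator picks the strong operator topology on the iterated space, for which no
`ContinuousENorm` instance is found; it is re-derived from the domination `norm_fderiv_fderiv_freeSlice_le_rpow`
wherever a consumer fixes the normed structure, as in `hasFDerivAt_fderiv_freeResolvent` below.) -/

/-! ## Differentiation under the integral sign -/

/-- **First derivative of the free resolvent**: `D(∫₀^∞ W_s ds)(y) = ∫₀^∞ DW_s(y) ds`. -/
theorem hasFDerivAt_freeResolvent (hF : ContDiff ℝ 1 F) (h0 : ∀ z, ‖F z‖ ≤ C₀) (h1 : ∀ z, ‖fderiv ℝ F z‖ ≤ C₁)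
    (α : ℝ) (y₀ : EuclideanSpace ℝ (Fin 3)) :
    HasFDerivAt (fun y => ∫ s in Ioi (0:ℝ), (Real.exp (-(s / 2)) • rotZL (-(α * s)))
        (heatExtension F (1 - Real.exp (-s)) ((Real.exp (-(s / 2)) • rotZL (α * s)) y)))
      (∫ s in Ioi (0:ℝ), fderiv ℝ (fun z => (Real.exp (-(s / 2)) • rotZL (-(α * s)))
        (heatExtension F (1 - Real.exp (-s)) ((Real.exp (-(s / 2)) • rotZL (α * s)) z))) y₀) y₀ := by
  have hFc := hF.continuous
  refine hasFDerivAt_integral_of_dominated_of_fderiv_le (𝕜 := ℝ) (μ := volume.restrict (Ioi (0:ℝ)))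
    (F := fun y s => (Real.exp (-(s / 2)) • rotZL (-(α * s)))
        (heatExtension F (1 - Real.exp (-s)) ((Real.exp (-(s / 2)) • rotZL (α * s)) y)))
    (F' := fun y s => fderiv ℝ (fun z => (Real.exp (-(s / 2)) • rotZL (-(α * s)))
        (heatExtension F (1 - Real.exp (-s)) ((Real.exp (-(s / 2)) • rotZL (α * s)) z))) y)
    (bound := fun s => C₁ * exp (-s)) (ball_mem_nhds y₀ zero_lt_one) ?_ ?_ ?_ ?_ ?_ ?_
  · exact Eventually.of_forall fun y => (continuousOn_freeSlice hFc h0 α y).aestronglyMeasurable measurableSet_Ioi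
  · exact integrableOn_freeSlice hFc h0 α y₀
  · exact (continuousOn_fderiv_freeSlice hFc h0 α y₀).aestronglyMeasurable measurableSet_Ioi
  · exact (ae_restrict_iff' measurableSet_Ioi).2
      (Eventually.of_forall fun s hs y _ => norm_fderiv_freeSlice_le_exp hF h0 h1 α hs y)
  · exact (integrableOn_exp_neg_Ioi 0).const_mul C₁
  · exact (ae_restrict_iff' measurableSet_Ioi).2 (Eventually.of_forall fun s hs y _ =>
      (hasFDerivAt_freeSlice_space hFc h0 α hs y).differentiableAt.hasFDerivAt)

/-- **Second derivative of the free resolvent**: `D(∫₀^∞ DW_s ds)(y) = ∫₀^∞ D²W_s(y) ds`. -/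
theorem hasFDerivAt_fderiv_freeResolvent (hF : ContDiff ℝ 1 F) (h0 : ∀ z, ‖F z‖ ≤ C₀)
    (h1 : ∀ z, ‖fderiv ℝ F z‖ ≤ C₁) (α : ℝ) (y₀ : EuclideanSpace ℝ (Fin 3)) :
    HasFDerivAt (fun y => ∫ s in Ioi (0:ℝ), fderiv ℝ (fun z => (Real.exp (-(s / 2)) • rotZL (-(α * s)))
        (heatExtension F (1 - Real.exp (-s)) ((Real.exp (-(s / 2)) • rotZL (α * s)) z))) y)
      (∫ s in Ioi (0:ℝ), fderiv ℝ (fun z => fderiv ℝ (fun z => (Real.exp (-(s / 2)) • rotZL (-(α * s)))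
        (heatExtension F (1 - Real.exp (-s)) ((Real.exp (-(s / 2)) • rotZL (α * s)) z))) z) y₀) y₀ := by
  have hFc := hF.continuous
  have hb : IntegrableOn (fun s : ℝ => (2 : ℝ) ^ ((3 : ℝ) / 2) * C₁ * (s ^ (-(1 / 2 : ℝ)) * exp (-s))) (Ioi 0) := by
    have h : IntegrableOn (fun s : ℝ => s ^ (-(1 / 2 : ℝ)) * exp (-((1:ℝ) * s))) (Ioi 0) :=
      integrableOn_rpow_neg_half_mul_exp_neg one_pos
    have h' : IntegrableOn (fun s : ℝ => s ^ (-(1 / 2 : ℝ)) * exp (-s)) (Ioi 0) :=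
      h.congr_fun (fun s _ => by simp only [one_mul]) measurableSet_Ioi
    exact h'.const_mul _
  refine hasFDerivAt_integral_of_dominated_of_fderiv_le (𝕜 := ℝ) (μ := volume.restrict (Ioi (0:ℝ)))
    (F := fun y s => fderiv ℝ (fun z => (Real.exp (-(s / 2)) • rotZL (-(α * s)))
        (heatExtension F (1 - Real.exp (-s)) ((Real.exp (-(s / 2)) • rotZL (α * s)) z))) y)
    (F' := fun y s => fderiv ℝ (fun z => fderiv ℝ (fun z => (Real.exp (-(s / 2)) • rotZL (-(α * s)))
        (heatExtension F (1 - Real.exp (-s)) ((Real.exp (-(s / 2)) • rotZL (α * s)) z))) z) y)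
    (bound := fun s => (2 : ℝ) ^ ((3 : ℝ) / 2) * C₁ * (s ^ (-(1 / 2 : ℝ)) * exp (-s)))
    (ball_mem_nhds y₀ zero_lt_one) ?_ ?_ ?_ ?_ hb ?_
  · exact Eventually.of_forall fun y =>
      (continuousOn_fderiv_freeSlice hFc h0 α y).aestronglyMeasurable measurableSet_Ioi
  · exact integrableOn_fderiv_freeSlice hF h0 h1 α y₀
  · exact (continuousOn_fderiv_fderiv_freeSlice hFc h0 α y₀).aestronglyMeasurable measurableSet_Ioi
  · exact (ae_restrict_iff' measurableSet_Ioi).2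
      (Eventually.of_forall fun s hs y _ => norm_fderiv_fderiv_freeSlice_le_rpow hF h0 h1 α hs y)
  · exact (ae_restrict_iff' measurableSet_Ioi).2 (Eventually.of_forall fun s hs y _ =>
      (hasFDerivAt_fderiv_freeSlice hFc h0 α hs y).differentiableAt.hasFDerivAt)

/-- The second derivative `y ↦ ∫₀^∞ D²W_s(y) ds` is continuous (dominated convergence; each `W_s` is smooth). -/
theorem continuous_fderiv_fderiv_freeResolvent (hF : ContDiff ℝ 1 F) (h0 : ∀ z, ‖F z‖ ≤ C₀)
    (h1 : ∀ z, ‖fderiv ℝ F z‖ ≤ C₁) (α : ℝ) :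
    Continuous fun y => ∫ s in Ioi (0:ℝ), fderiv ℝ (fun z => fderiv ℝ (fun z => (Real.exp (-(s / 2)) • rotZL (-(α * s)))
        (heatExtension F (1 - Real.exp (-s)) ((Real.exp (-(s / 2)) • rotZL (α * s)) z))) z) y := by
  have hFc := hF.continuous
  have hb : IntegrableOn (fun s : ℝ => (2 : ℝ) ^ ((3 : ℝ) / 2) * C₁ * (s ^ (-(1 / 2 : ℝ)) * exp (-s))) (Ioi 0) := by
    have h : IntegrableOn (fun s : ℝ => s ^ (-(1 / 2 : ℝ)) * exp (-((1:ℝ) * s))) (Ioi 0) :=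
      integrableOn_rpow_neg_half_mul_exp_neg one_pos
    have h' : IntegrableOn (fun s : ℝ => s ^ (-(1 / 2 : ℝ)) * exp (-s)) (Ioi 0) :=
      h.congr_fun (fun s _ => by simp only [one_mul]) measurableSet_Ioi
    exact h'.const_mul _
  refine continuous_of_dominated (μ := volume.restrict (Ioi (0:ℝ)))
    (bound := fun s => (2 : ℝ) ^ ((3 : ℝ) / 2) * C₁ * (s ^ (-(1 / 2 : ℝ)) * exp (-s))) ?_ ?_ hb ?_
  · exact fun y => (continuousOn_fderiv_fderiv_freeSlice hFc h0 α y).aestronglyMeasurable measurableSet_Ioi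
  · exact fun y => (ae_restrict_iff' measurableSet_Ioi).2
      (Eventually.of_forall fun s hs => norm_fderiv_fderiv_freeSlice_le_rpow hF h0 h1 α hs y)
  · refine (ae_restrict_iff' measurableSet_Ioi).2 (Eventually.of_forall fun s hs => ?_)
    -- the slice is smooth in space
    have hsm : ContDiff ℝ 2 (fun z => (Real.exp (-(s / 2)) • rotZL (-(α * s)))
        (heatExtension F (1 - Real.exp (-s)) ((Real.exp (-(s / 2)) • rotZL (α * s)) z))) :=
      (Real.exp (-(s / 2)) • rotZL (-(α * s))).contDiff.comp
        ((contDiff_heatExtension_of_bound hFc h0 (heatTime_mem_Ioc hs).1).comp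
          (Real.exp (-(s / 2)) • rotZL (α * s)).contDiff)
    exact (hsm.fderiv_right (m := 1) le_rfl).continuous_fderiv one_ne_zero

/-- **The free resolvent is `C²`.** -/
theorem contDiff_two_freeResolvent (hF : ContDiff ℝ 1 F) (h0 : ∀ z, ‖F z‖ ≤ C₀) (h1 : ∀ z, ‖fderiv ℝ F z‖ ≤ C₁)
    (α : ℝ) :
    ContDiff ℝ 2 (fun y => ∫ s in Ioi (0:ℝ), (Real.exp (-(s / 2)) • rotZL (-(α * s)))
        (heatExtension F (1 - Real.exp (-s)) ((Real.exp (-(s / 2)) • rotZL (α * s)) y))) := by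
  have h2 : ContDiff ℝ 1 (fun y => ∫ s in Ioi (0:ℝ), fderiv ℝ (fun z => (Real.exp (-(s / 2)) • rotZL (-(α * s)))
        (heatExtension F (1 - Real.exp (-s)) ((Real.exp (-(s / 2)) • rotZL (α * s)) z))) y) :=
    contDiff_one_iff_hasFDerivAt.2 ⟨_, continuous_fderiv_fderiv_freeResolvent hF h0 h1 α,
      fun y => hasFDerivAt_fderiv_freeResolvent hF h0 h1 α y⟩
  have h : ContDiff ℝ ((1 : ℕ) + 1 : ℕ) (fun y => ∫ s in Ioi (0:ℝ), (Real.exp (-(s / 2)) • rotZL (-(α * s)))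
        (heatExtension F (1 - Real.exp (-s)) ((Real.exp (-(s / 2)) • rotZL (α * s)) y))) :=
    contDiff_succ_iff_hasFDerivAt.2 ⟨_, h2, fun y => hasFDerivAt_freeResolvent hF h0 h1 α y⟩
  exact h

/-! ## The X-scale decay of the free resolvent -/

/-- **`(1+|y|) ‖W(y)‖ ≤ 4 C_G A`** when `(1+|z|)² ‖F z‖ ≤ A` (the transport kernel integrates to `2/(1+|y|)`). -/
theorem weight_norm_freeResolvent_le {C_G : ℝ} (hCG : 0 ≤ C_G)
    (hG : ∀ ⦃t : ℝ⦄, 0 < t → ∀ {f : EuclideanSpace ℝ (Fin 3) → EuclideanSpace ℝ (Fin 3)}, Continuous f → ∀ {A : ℝ},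
      (∀ y, (1 + ‖y‖) ^ 2 * ‖f y‖ ≤ A) → ∀ x : EuclideanSpace ℝ (Fin 3),
        (1 + ‖x‖) ^ 2 * ‖heatExtension f t x‖ ≤ C_G * (1 + t ^ (3 / 2 : ℝ)) * A)
    (hF : Continuous F) {A : ℝ} (hA : ∀ z, (1 + ‖z‖) ^ 2 * ‖F z‖ ≤ A) (α : ℝ) (y : EuclideanSpace ℝ (Fin 3)) :
    (1 + ‖y‖) * ‖∫ s in Ioi (0:ℝ), (Real.exp (-(s / 2)) • rotZL (-(α * s)))
        (heatExtension F (1 - Real.exp (-s)) ((Real.exp (-(s / 2)) • rotZL (α * s)) y))‖ ≤ 4 * C_G * A := by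
  have hker := transport_kernel_integral (norm_nonneg y)
  have h1 : ‖∫ s in Ioi (0:ℝ), (Real.exp (-(s / 2)) • rotZL (-(α * s)))
        (heatExtension F (1 - Real.exp (-s)) ((Real.exp (-(s / 2)) • rotZL (α * s)) y))‖ ≤
      ∫ s in Ioi (0:ℝ), 2 * C_G * A * (exp (s / 2) / (exp (s / 2) + ‖y‖) ^ 2) := by
    refine norm_integral_le_of_norm_le (hker.1.const_mul (2 * C_G * A)) ?_
    exact (ae_restrict_iff' measurableSet_Ioi).2
      (Eventually.of_forall fun s hs => norm_freeSlice_le_kernel hCG hG hF hA α hs y)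
  rw [integral_const_mul, hker.2] at h1
  have hy : 0 < 1 + ‖y‖ := by positivity
  calc (1 + ‖y‖) * ‖∫ s in Ioi (0:ℝ), (Real.exp (-(s / 2)) • rotZL (-(α * s)))
        (heatExtension F (1 - Real.exp (-s)) ((Real.exp (-(s / 2)) • rotZL (α * s)) y))‖
      ≤ (1 + ‖y‖) * (2 * C_G * A * (2 / (1 + ‖y‖))) := mul_le_mul_of_nonneg_left h1 hy.le
    _ = 4 * C_G * A := by field_simp; ring

/-- **`(1+|y|) ‖∫₀^∞ DW_s(y) ds‖ ≤ 4 C_G A'`** when `F ∈ C¹`, `‖F‖ ≤ C₀`, `(1+|z|)² ‖DF z‖ ≤ A'`. -/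
theorem weight_norm_fderiv_freeResolvent_le {C_G : ℝ} (hCG : 0 ≤ C_G)
    (hG : ∀ ⦃t : ℝ⦄, 0 < t → ∀ {f : EuclideanSpace ℝ (Fin 3) → EuclideanSpace ℝ (Fin 3) →L[ℝ] EuclideanSpace ℝ (Fin 3)},
      Continuous f → ∀ {A : ℝ}, (∀ y, (1 + ‖y‖) ^ 2 * ‖f y‖ ≤ A) → ∀ x : EuclideanSpace ℝ (Fin 3),
        (1 + ‖x‖) ^ 2 * ‖heatExtension f t x‖ ≤ C_G * (1 + t ^ (3 / 2 : ℝ)) * A)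
    (hF : ContDiff ℝ 1 F) (h0 : ∀ z, ‖F z‖ ≤ C₀) {A' : ℝ} (hA' : ∀ z, (1 + ‖z‖) ^ 2 * ‖fderiv ℝ F z‖ ≤ A')
    (α : ℝ) (y : EuclideanSpace ℝ (Fin 3)) :
    (1 + ‖y‖) * ‖∫ s in Ioi (0:ℝ), fderiv ℝ (fun z => (Real.exp (-(s / 2)) • rotZL (-(α * s)))
        (heatExtension F (1 - Real.exp (-s)) ((Real.exp (-(s / 2)) • rotZL (α * s)) z))) y‖ ≤ 4 * C_G * A' := by
  have hI := integral_exp_neg_half_Ioi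
  have h1 : ‖∫ s in Ioi (0:ℝ), fderiv ℝ (fun z => (Real.exp (-(s / 2)) • rotZL (-(α * s)))
        (heatExtension F (1 - Real.exp (-s)) ((Real.exp (-(s / 2)) • rotZL (α * s)) z))) y‖ ≤
      ∫ s in Ioi (0:ℝ), 2 * C_G * A' / (1 + ‖y‖) * exp (-(s / 2)) := by
    refine norm_integral_le_of_norm_le (hI.1.const_mul _) ?_
    refine (ae_restrict_iff' measurableSet_Ioi).2 (Eventually.of_forall fun s hs => ?_)
    have h := norm_fderiv_freeSlice_le_weight hCG hG hF h0 hA' α hs y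
    calc _ ≤ 2 * C_G * A' * (exp (-(s / 2)) / (1 + ‖y‖)) := h
      _ = 2 * C_G * A' / (1 + ‖y‖) * exp (-(s / 2)) := by ring
  rw [integral_const_mul, hI.2] at h1
  have hy : 0 < 1 + ‖y‖ := by positivity
  calc (1 + ‖y‖) * ‖∫ s in Ioi (0:ℝ), fderiv ℝ (fun z => (Real.exp (-(s / 2)) • rotZL (-(α * s)))
        (heatExtension F (1 - Real.exp (-s)) ((Real.exp (-(s / 2)) • rotZL (α * s)) z))) y‖
      ≤ (1 + ‖y‖) * (2 * C_G * A' / (1 + ‖y‖) * 2) := mul_le_mul_of_nonneg_left h1 hy.le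
    _ = 4 * C_G * A' := by field_simp; ring

/-- **`(1+|y|) ‖∫₀^∞ D²W_s(y) ds‖ ≤ 5·2^{3/2} C_G A' · ∫₀^∞ s^{-1/2} e^{-s/2} ds`** under the same hypotheses and the
weighted gradient estimate of `sq_weight_fderiv_heatExtension_le`. -/
theorem weight_norm_fderiv_fderiv_freeResolvent_le {C_G : ℝ} (hCG : 0 ≤ C_G)
    (hG' : ∀ ⦃t : ℝ⦄, 0 < t → ∀ {f : EuclideanSpace ℝ (Fin 3) → EuclideanSpace ℝ (Fin 3) →L[ℝ] EuclideanSpace ℝ (Fin 3)},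
      Continuous f → ∀ {A : ℝ}, (∀ y, (1 + ‖y‖) ^ 2 * ‖f y‖ ≤ A) → ∀ x : EuclideanSpace ℝ (Fin 3),
        (1 + ‖x‖) ^ 2 * ‖fderiv ℝ (heatExtension f t) x‖ ≤
          (2 : ℝ) ^ ((3 : ℝ) / 2) * t ^ (-(1 / 2 : ℝ)) * (C_G * (1 + (2 * t) ^ (3 / 2 : ℝ)) * A))
    (hF : ContDiff ℝ 1 F) (h0 : ∀ z, ‖F z‖ ≤ C₀) {A' : ℝ} (hA' : ∀ z, (1 + ‖z‖) ^ 2 * ‖fderiv ℝ F z‖ ≤ A')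
    (α : ℝ) (y : EuclideanSpace ℝ (Fin 3)) :
    (1 + ‖y‖) * ‖∫ s in Ioi (0:ℝ), fderiv ℝ (fun z => fderiv ℝ (fun z => (Real.exp (-(s / 2)) • rotZL (-(α * s)))
        (heatExtension F (1 - Real.exp (-s)) ((Real.exp (-(s / 2)) • rotZL (α * s)) z))) z) y‖ ≤
      5 * (2 : ℝ) ^ ((3 : ℝ) / 2) * C_G * A' * ∫ s in Ioi (0:ℝ), s ^ (-(1 / 2 : ℝ)) * exp (-(s / 2)) := by
  have hI : IntegrableOn (fun s : ℝ => s ^ (-(1 / 2 : ℝ)) * exp (-(s / 2))) (Ioi 0) := by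
    have h : IntegrableOn (fun s : ℝ => s ^ (-(1 / 2 : ℝ)) * exp (-((1 / 2 : ℝ) * s))) (Ioi 0) :=
      integrableOn_rpow_neg_half_mul_exp_neg (by norm_num)
    exact h.congr_fun (fun s _ => by beta_reduce; rw [show -((1 / 2 : ℝ) * s) = -(s / 2) by ring]) measurableSet_Ioi
  set K : ℝ := 5 * (2 : ℝ) ^ ((3 : ℝ) / 2) * C_G * A' with hK
  have h1 : ‖∫ s in Ioi (0:ℝ), fderiv ℝ (fun z => fderiv ℝ (fun z => (Real.exp (-(s / 2)) • rotZL (-(α * s)))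
        (heatExtension F (1 - Real.exp (-s)) ((Real.exp (-(s / 2)) • rotZL (α * s)) z))) z) y‖ ≤
      ∫ s in Ioi (0:ℝ), K / (1 + ‖y‖) * (s ^ (-(1 / 2 : ℝ)) * exp (-(s / 2))) := by
    refine norm_integral_le_of_norm_le (hI.const_mul _) ?_
    refine (ae_restrict_iff' measurableSet_Ioi).2 (Eventually.of_forall fun s hs => ?_)
    have h := norm_fderiv_fderiv_freeSlice_le_weight hCG hG' hF h0 hA' α hs y
    calc _ ≤ K * (s ^ (-(1 / 2 : ℝ)) * exp (-(s / 2)) / (1 + ‖y‖)) := h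
      _ = K / (1 + ‖y‖) * (s ^ (-(1 / 2 : ℝ)) * exp (-(s / 2))) := by ring
  rw [integral_const_mul] at h1
  have hy : 0 < 1 + ‖y‖ := by positivity
  calc (1 + ‖y‖) * ‖∫ s in Ioi (0:ℝ), fderiv ℝ (fun z => fderiv ℝ (fun z => (Real.exp (-(s / 2)) • rotZL (-(α * s)))
        (heatExtension F (1 - Real.exp (-s)) ((Real.exp (-(s / 2)) • rotZL (α * s)) z))) z) y‖
      ≤ (1 + ‖y‖) * (K / (1 + ‖y‖) * ∫ s in Ioi (0:ℝ), s ^ (-(1 / 2 : ℝ)) * exp (-(s / 2))) :=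
        mul_le_mul_of_nonneg_left h1 hy.le
    _ = K * ∫ s in Ioi (0:ℝ), s ^ (-(1 / 2 : ℝ)) * exp (-(s / 2)) := by field_simp

end Resolvent

end Summit.NavierStokesRegularity.NavierStokesRegularity.Theorems.KelvinGate

end
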